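import Mathlib
import Literature.NumberTheory.Transcendental.KZCalculusProofs
import Literature.NumberTheory.Transcendental.KZLogCalculusProofs
import Literature.NumberTheory.Transcendental.KZHomotopyMoves
import Literature.NumberTheory.Transcendental.KZProductIdeal
import Literature.NumberTheory.Transcendental.KZSemialgebraicComplex
import Literature.NumberTheory.Transcendental.KZIdealTetrahedron
import Literature.NumberTheory.Transcendental.KZIntervalPeriodProofs
import Literature.NumberTheory.Transcendental.KZDominatedFamilyRelations
import Summits.KontsevichZagierPeriods.KontsevichZagierPeriods.Theorems.HyperbolicBlochOffTetraSectorKernelAbelFiveTermLog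

/-!
# `OffTetraSectorKernel` (stmt-KontsevichZagierPeriods-10557), line `odd-hyperbolic-ladder`: stub `stub_abelFiveTerm`

**ABEL'S FIVE-TERM EQUATION OF THE REAL DILOGARITHM INSIDE THE KONTSEVICH–ZAGIER CALCULUS.** For real
algebraic `0 < x, y < 1`, with `X = x(1−y)/(1−xy)`, `Y = y(1−x)/(1−xy)` and the carriers
`[T a] = [{0 < t < u < a}, 1/(u(1−t))]` (value `Li₂(a)`), `[N(a,b)] = [(1,a)×(1,b), 1/(uw)]` (value
`log a log b`):

`[T x] + [T y] − [T xy] − [T X] − [T Y] − [N((1−xy)/(1−x), (1−xy)/(1−y))] ∈ KZ.relations`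

(value: `Li₂(x) + Li₂(y) − Li₂(xy) − Li₂(X) − Li₂(Y) − log((1−x)/(1−xy))·log((1−y)/(1−xy)) = 0`,
Abel 1826, Spence 1809). The chain of moves is a HOMOTOPY in `y`: writing `t ∈ (0, y)` for the moving
second argument, `P(t) = (1−xt)/(1−x)`, `Q(t) = (1−xt)/(1−t)` (`X(t) = x·q(t)`, `Y(t) = t·p(t)` with
`p = 1/P`, `q = 1/Q`),
* the dilogarithm side is move-equivalent to four unfolded-logarithm bands over `(0, y)`
  (`abel_term_X`, `abel_term_xy`, `abel_term_Y`, `abel_triangle_sub_band`: dissection, shear, flip,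
  fibre substitution, Möbius base changes — rules (1a), (2)):
  `[T x] − [T X] ≡ [CX] = ⟨Q′/Q | P⟩`, `[T y] ≡ [By] = ⟨1/t | 1/(1−t)⟩`, `[T xy] ≡ [Cxy] = ⟨1/t | 1/(1−xt)⟩`,
  `[T Y] ≡ [CY] = ⟨1/t − P′/P | Q⟩` (`⟨G | V⟩ := [{0<t<y, 1 ≤ w ≤ V(t)}, G(t)/w]`);
* the logarithmic side is `[N] ≡ [CX] − [DS]`, `DS = ⟨−P′/P | Q⟩` (`abel_logSide`: the rectangle swept by
  the curve `t ↦ (P(t),Q(t))` — integration by parts inside the calculus);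
* the `P`-bands CANCEL IDENTICALLY, the `Q`-bands merge by ONE integrand additivity (rule (1b)):
  `[CY] − [DS] ≡ ⟨1/t | Q⟩`, and what remains, `⟨1/t | 1/(1−t)⟩ − ⟨1/t | 1/(1−xt)⟩ − ⟨1/t | Q⟩`, is ONE
  fibred product rule `log(1/(1−t)) = log(1/(1−xt)) + log Q(t)` (`KZ.of_sub_of_sub_mem_relations_mul`,
  rules (1a)+(2)).

References: N. H. Abel, *Note sur la fonction ψx = x + x²/2² + ⋯* (1826), Œuvres II, 189–193;
W. Spence (1809); L. J. Rogers, Proc. LMS (2) 4 (1907) 169–189; D. Zagier, *The dilogarithm function*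
(2007), §I.2; M. Kontsevich, D. Zagier, *Periods* (2001), §1.2.
-/

noncomputable section

open Set MeasureTheory
open Literature.NumberTheory.Transcendental Literature.ModelTheory.ExponentialFields

namespace Summit.KontsevichZagierPeriods.HyperbolicBloch.OffTetraSectorKernel

/-! ### The five bands over the homotopy interval exist -/

/-- The unfolded-logarithm bands over the homotopy interval `(0, y)` used by the assembly exist:
`⟨G | V⟩ = [{0<t<y, 1 ≤ w ≤ V(t)}, G(t)/w]` for `(G, V)` = `((1−x)/((1−xt)(1−t)), P)`, `(1/t, 1/(1−xt))`,
`(1/(t(1−xt)), Q)`, `(x/(1−xt), Q)`, `(1/t, Q)` — in each case `|G|(V−1)` is bounded on `(0, y)`.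
[cite: KontsevichZagier2001, §1.1] -/
theorem abel_exists_fiveBands {x y : ℝ} (hx : IsAlgebraic ℚ x) (hy : IsAlgebraic ℚ y) (hx0 : 0 < x)
    (hx1 : x < 1) (hy1 : y < 1) :
    (∃ CX : KZ.IntegralRep 2, CX.domain = {z | (0 < z 0 ∧ z 0 < y) ∧ 1 ≤ z 1 ∧ z 1 ≤ (1 - x * z 0) / (1 - x)} ∧
      CX.integrand = fun z => (1 - x) / ((1 - x * z 0) * (1 - z 0)) / z 1) ∧
    (∃ Cxy : KZ.IntegralRep 2, Cxy.domain = {z | (0 < z 0 ∧ z 0 < y) ∧ 1 ≤ z 1 ∧ z 1 ≤ 1 / (1 - x * z 0)} ∧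
      Cxy.integrand = fun z => 1 / z 0 / z 1) ∧
    (∃ CY : KZ.IntegralRep 2, CY.domain = {z | (0 < z 0 ∧ z 0 < y) ∧ 1 ≤ z 1 ∧ z 1 ≤ (1 - x * z 0) / (1 - z 0)} ∧
      CY.integrand = fun z => 1 / (z 0 * (1 - x * z 0)) / z 1) ∧
    (∃ DS : KZ.IntegralRep 2, DS.domain = {z | (0 < z 0 ∧ z 0 < y) ∧ 1 ≤ z 1 ∧ z 1 ≤ (1 - x * z 0) / (1 - z 0)} ∧
      DS.integrand = fun z => x / (1 - x * z 0) / z 1) ∧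
    (∃ E : KZ.IntegralRep 2, E.domain = {z | (0 < z 0 ∧ z 0 < y) ∧ 1 ≤ z 1 ∧ z 1 ≤ (1 - x * z 0) / (1 - z 0)} ∧
      E.integrand = fun z => 1 / z 0 / z 1) := by
  have hσ : IsSemialgebraic ℚ {p : Fin 1 → ℝ | 0 < p 0 ∧ p 0 < y} := isSemialgebraic_logIvl isAlgebraic_zero hy
  -- the Möbius atoms on `(0, y)`
  have mob : ∀ {a b c d : ℝ}, IsAlgebraic ℚ a → IsAlgebraic ℚ b → IsAlgebraic ℚ c → IsAlgebraic ℚ d →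
      (∀ t : ℝ, 0 < t → t < y → c * t + d ≠ 0) →
      IsSemialgebraicFunOn ℚ {p : Fin 1 → ℝ | 0 < p 0 ∧ p 0 < y} (fun p => (a * p 0 + b) / (c * p 0 + d)) :=
    fun ha hb hc hd hden => abel_isSemialgebraicFunOn_moebius hσ 0 ha hb hc hd fun p hp => hden _ hp.1 hp.2
  have hinv : IsSemialgebraicFunOn ℚ {p : Fin 1 → ℝ | 0 < p 0 ∧ p 0 < y} (fun p => 1 / p 0) :=
    (mob isAlgebraic_zero isAlgebraic_one isAlgebraic_one isAlgebraic_zero (fun t ht _ => by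
      simp; exact ht.ne')).congr fun p _ => by simp
  have hixt : IsSemialgebraicFunOn ℚ {p : Fin 1 → ℝ | 0 < p 0 ∧ p 0 < y} (fun p => 1 / (1 - x * p 0)) :=
    (mob isAlgebraic_zero isAlgebraic_one hx.neg isAlgebraic_one (fun t _ ht => by nlinarith)).congr
      fun p _ => by simp; ring
  have hP : IsSemialgebraicFunOn ℚ {p : Fin 1 → ℝ | 0 < p 0 ∧ p 0 < y} (fun p => (1 - x * p 0) / (1 - x)) :=
    (mob hx.neg isAlgebraic_one isAlgebraic_zero (isAlgebraic_one.sub hx) (fun t _ _ => by nlinarith)).congr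
      fun p _ => by simp; ring
  have hQ : IsSemialgebraicFunOn ℚ {p : Fin 1 → ℝ | 0 < p 0 ∧ p 0 < y} (fun p => (1 - x * p 0) / (1 - p 0)) :=
    (mob hx.neg isAlgebraic_one isAlgebraic_one.neg isAlgebraic_one (fun t _ ht => by nlinarith)).congr
      fun p _ => by simp; ring
  have h1t : IsSemialgebraicFunOn ℚ {p : Fin 1 → ℝ | 0 < p 0 ∧ p 0 < y} (fun p => (1 - x) / (1 - p 0)) :=
    (mob isAlgebraic_zero (isAlgebraic_one.sub hx) isAlgebraic_one.neg isAlgebraic_one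
      (fun t _ ht => by nlinarith)).congr fun p _ => by simp; ring
  have hxxt : IsSemialgebraicFunOn ℚ {p : Fin 1 → ℝ | 0 < p 0 ∧ p 0 < y} (fun p => x / (1 - x * p 0)) :=
    (mob isAlgebraic_zero hx hx.neg isAlgebraic_one (fun t _ ht => by nlinarith)).congr
      fun p _ => by simp; ring
  have hQ1 : ∀ t, 0 < t → t < y → 1 ≤ (1 - x * t) / (1 - t) := fun t ht0 ht1 => by
    rw [le_div_iff₀ (by linarith)]; nlinarith
  have hQb : ∀ t, 0 < t → t < y → (1 - x * t) / (1 - t) - 1 = t * (1 - x) / (1 - t) := fun t ht0 ht1 => by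
    have : 1 - t ≠ 0 := by linarith
    field_simp; ring
  refine ⟨?_, ?_, ?_, ?_, ?_⟩
  · -- `CX`
    refine abel_exists_band isAlgebraic_zero hy (fun t => (1 - x) / ((1 - x * t) * (1 - t)))
      (fun t => (1 - x * t) / (1 - x)) (x / (1 - x)) ((IsSemialgebraicFunOn.mul_holds hixt h1t).congr
        fun p hp => ?_) hP (fun t ht0 ht1 => ?_) (fun t ht0 ht1 => ?_)
    · have h1 : 1 - x * p 0 ≠ 0 := by have := hp.1; have := hp.2; nlinarith
      have h2 : 1 - p 0 ≠ 0 := by have := hp.2; linarith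
      simp only [Pi.mul_apply]
      field_simp
    · rw [le_div_iff₀ (by linarith)]; nlinarith
    · have h1 : 0 < 1 - x * t := by nlinarith
      have h2 : 0 < 1 - t := by linarith
      have hG : 0 < (1 - x) / ((1 - x * t) * (1 - t)) := by positivity
      rw [abs_of_pos hG]
      have h1' : 1 - x * t ≠ 0 := h1.ne'
      have h1'' : 1 - t * x ≠ 0 := by rw [mul_comm]; exact h1.ne'
      have h2' : 1 - t ≠ 0 := h2.ne'
      have h3 : 1 - x ≠ 0 := by linarith
      have : (1 - x) / ((1 - x * t) * (1 - t)) * ((1 - x * t) / (1 - x) - 1) = x / (1 - x * t) := by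
        rw [div_sub_one h3, div_mul_div_comm, div_eq_div_iff (by positivity) h1']
        ring
      rw [this]
      exact div_le_div_of_nonneg_left hx0.le (by linarith) (by nlinarith)
  · -- `Cxy`
    refine abel_exists_band isAlgebraic_zero hy (fun t => 1 / t) (fun t => 1 / (1 - x * t)) (x / (1 - x))
      hinv hixt (fun t ht0 ht1 => ?_) (fun t ht0 ht1 => ?_)
    · rw [le_div_iff₀ (by nlinarith)]; nlinarith
    · have h1 : 0 < 1 - x * t := by nlinarith
      rw [abs_of_pos (one_div_pos.2 ht0)]
      have : 1 / t * (1 / (1 - x * t) - 1) = x / (1 - x * t) := by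
        have e : 1 / (1 - x * t) - 1 = (x * t) / (1 - x * t) := by
          rw [eq_div_iff h1.ne', sub_mul, div_mul_cancel₀ _ h1.ne']; ring
        rw [e, div_mul_div_comm, div_eq_div_iff (mul_ne_zero ht0.ne' h1.ne') h1.ne']
        ring
      rw [this]
      exact div_le_div_of_nonneg_left hx0.le (by linarith) (by nlinarith)
  · -- `CY`
    refine abel_exists_band isAlgebraic_zero hy (fun t => 1 / (t * (1 - x * t))) (fun t => (1 - x * t) / (1 - t))
      (1 / (1 - y)) ((IsSemialgebraicFunOn.mul_holds hinv hixt).congr fun p hp => ?_) hQ hQ1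
      (fun t ht0 ht1 => ?_)
    · have h1 : 1 - x * p 0 ≠ 0 := by have := hp.1; have := hp.2; nlinarith
      simp only [Pi.mul_apply]
      rw [div_mul_div_comm, one_mul]
    · have h1 : 0 < 1 - x * t := by nlinarith
      have h2 : 0 < 1 - t := by linarith
      rw [hQb t ht0 ht1, abs_of_pos (by positivity)]
      have : 1 / (t * (1 - x * t)) * (t * (1 - x) / (1 - t)) = (1 - x) / (1 - x * t) * (1 / (1 - t)) := by
        field_simp
      rw [this]
      calc (1 - x) / (1 - x * t) * (1 / (1 - t)) ≤ 1 * (1 / (1 - y)) := by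
            apply mul_le_mul _ _ (by positivity) zero_le_one
            · rw [div_le_one h1]; nlinarith
            · exact one_div_le_one_div_of_le (by linarith) (by linarith)
        _ = 1 / (1 - y) := one_mul _
  · -- `DS`
    refine abel_exists_band isAlgebraic_zero hy (fun t => x / (1 - x * t)) (fun t => (1 - x * t) / (1 - t))
      (1 / (1 - y)) hxxt hQ hQ1 (fun t ht0 ht1 => ?_)
    have h1 : 0 < 1 - x * t := by nlinarith
    have h2 : 0 < 1 - t := by linarith
    rw [hQb t ht0 ht1, abs_of_pos (by positivity)]
    have : x / (1 - x * t) * (t * (1 - x) / (1 - t)) = (x * t) * ((1 - x) / (1 - x * t)) * (1 / (1 - t)) := by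
      field_simp
    rw [this]
    calc (x * t) * ((1 - x) / (1 - x * t)) * (1 / (1 - t)) ≤ 1 * 1 * (1 / (1 - y)) := by
          apply mul_le_mul (mul_le_mul (by nlinarith) _ (by positivity) zero_le_one) _ (by positivity)
            (by positivity)
          · rw [div_le_one h1]; nlinarith
          · exact one_div_le_one_div_of_le (by linarith) (by linarith)
      _ = 1 / (1 - y) := by ring
  · -- `E`
    refine abel_exists_band isAlgebraic_zero hy (fun t => 1 / t) (fun t => (1 - x * t) / (1 - t))
      (1 / (1 - y)) hinv hQ hQ1 (fun t ht0 ht1 => ?_)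
    have h2 : 0 < 1 - t := by linarith
    rw [hQb t ht0 ht1, abs_of_pos (one_div_pos.2 ht0)]
    have : 1 / t * (t * (1 - x) / (1 - t)) = (1 - x) * (1 / (1 - t)) := by
      field_simp
    rw [this]
    calc (1 - x) * (1 / (1 - t)) ≤ 1 * (1 / (1 - y)) := by
          apply mul_le_mul (by linarith) _ (by positivity) zero_le_one
          exact one_div_le_one_div_of_le (by linarith) (by linarith)
      _ = 1 / (1 - y) := one_mul _

/-! ### The stub -/

/-- STUB `stub_abelFiveTerm` (lead; the assembly): ABEL'S FIVE-TERM EQUATION INSIDE THE CALCULUS — for real algebraic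
`0 < x, y < 1`, `[T x] + [T y] − [T xy] − [T (x(1−y)/(1−xy))] − [T (y(1−x)/(1−xy))] − [N((1−xy)/(1−x),(1−xy)/(1−y))]`
is a relation (value: `Li₂(x)+Li₂(y)−Li₂(xy)−Li₂(X)−Li₂(Y) − log((1−x)/(1−xy)) log((1−y)/(1−xy)) = 0`). Chain:
homotopy in `y`; strips (`stub_dilogShear`, one dissection) → unfolded-log bands (`stub_stripToLogBand`) → common base
`(0, y)` by the Möbius base changes `u = x y'`, `u = Y(y')`, `u = X(y')` (`stub_moebiusCovLift`); the log rectangle is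
swept (`stub_logRectSweep`) and re-based along `Q`, `P`; the `P`-bands cancel identically (`X = x·q`), the `Q`-bands
merge by rule (1b) (`Y = y·p`), and the remaining three bands are ONE fibred product rule
`1/(1−y') = (1/(1−xy'))·((1−xy')/(1−y'))` (`KZ.of_sub_of_sub_mem_relations_mul`).
[cite: KontsevichZagier2001, §1.2] -/
theorem stub_abelFiveTerm :
    ∀ (x y : ℝ), IsAlgebraic ℚ x → IsAlgebraic ℚ y → 0 < x → x < 1 → 0 < y → y < 1 →
    ∀ (Lx Ly Lxy LX LY M : KZ.IntegralRep 2),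
      Lx.domain = {w | 0 < w 1 ∧ w 1 < w 0 ∧ w 0 < x} →
      Set.EqOn Lx.integrand (fun w => 1 / (w 0 * (1 - w 1))) Lx.domain →
      Ly.domain = {w | 0 < w 1 ∧ w 1 < w 0 ∧ w 0 < y} →
      Set.EqOn Ly.integrand (fun w => 1 / (w 0 * (1 - w 1))) Ly.domain →
      Lxy.domain = {w | 0 < w 1 ∧ w 1 < w 0 ∧ w 0 < x * y} →
      Set.EqOn Lxy.integrand (fun w => 1 / (w 0 * (1 - w 1))) Lxy.domain →
      LX.domain = {w | 0 < w 1 ∧ w 1 < w 0 ∧ w 0 < x * (1 - y) / (1 - x * y)} →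
      Set.EqOn LX.integrand (fun w => 1 / (w 0 * (1 - w 1))) LX.domain →
      LY.domain = {w | 0 < w 1 ∧ w 1 < w 0 ∧ w 0 < y * (1 - x) / (1 - x * y)} →
      Set.EqOn LY.integrand (fun w => 1 / (w 0 * (1 - w 1))) LY.domain →
      M.domain = {w | 1 < w 0 ∧ w 0 < (1 - x * y) / (1 - x) ∧ 1 < w 1 ∧ w 1 < (1 - x * y) / (1 - y)} →
      Set.EqOn M.integrand (fun w => 1 / (w 0 * w 1)) M.domain →
      KZ.of Lx + KZ.of Ly - KZ.of Lxy - KZ.of LX - KZ.of LY - KZ.of M ∈ KZ.relations := by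
  intro x y hx hy hx0 hx1 hy0 hy1 Lx Ly Lxy LX LY M hLx hLxi hLy hLyi hLxy hLxyi hLX hLXi hLY hLYi hM hMi
  obtain ⟨⟨CX, hCXd, hCXi⟩, ⟨Cxy, hCxyd, hCxyi⟩, ⟨CY, hCYd, hCYi⟩, ⟨DS, hDSd, hDSi⟩, ⟨E, hEd, hEi⟩⟩ :=
    abel_exists_fiveBands hx hy hx0 hx1 hy1
  obtain ⟨By, hByd, hByi⟩ := abel_exists_dilogBand 0 y isAlgebraic_zero hy le_rfl hy1
  -- pointwise forms of the band integrands
  have hCXi' : EqOn CX.integrand (fun z => (1 - x) / ((1 - x * z 0) * (1 - z 0) * z 1)) CX.domain :=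
    fun z _ => by rw [hCXi]; simp only [div_div]
  have hCxyi' : EqOn Cxy.integrand (fun z => 1 / (z 0 * z 1)) Cxy.domain :=
    fun z _ => by rw [hCxyi]; simp only [div_div]
  have hCYi' : EqOn CY.integrand (fun z => 1 / (z 0 * (1 - x * z 0) * z 1)) CY.domain :=
    fun z _ => by rw [hCYi]; simp only [div_div]
  have hDSi' : EqOn DS.integrand (fun z => x / ((1 - x * z 0) * z 1)) DS.domain :=
    fun z _ => by rw [hDSi]; simp only [div_div]
  -- the dilogarithm side
  have hX : KZ.of Lx - KZ.of LX - KZ.of CX ∈ KZ.relations :=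
    abel_term_X x y hx hy hx0 hx1 hy0 hy1 Lx LX CX hLx hLxi hLX hLXi hCXd hCXi'
  have hLy' : KZ.of Ly - KZ.of By ∈ KZ.relations :=
    abel_triangle_sub_band hy hy0 hy1 Ly By hLy hLyi hByd fun w _ => by rw [hByi]; simp only [div_div]
  have hxy : KZ.of Lxy - KZ.of Cxy ∈ KZ.relations :=
    abel_term_xy hx hy hx0 hx1 hy0 hy1 Lxy Cxy hLxy hLxyi hCxyd hCxyi'
  have hY : KZ.of LY - KZ.of CY ∈ KZ.relations :=
    abel_term_Y x y hx hy hx0 hx1 hy0 hy1 LY CY hLY hLYi hCYd hCYi'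
  -- the logarithmic side
  have hlog : KZ.of M - KZ.of CX + KZ.of DS ∈ KZ.relations :=
    abel_logSide x y hx hy hx0 hx1 hy0 hy1 M CX DS hM hMi hCXd hCXi' hDSd hDSi'
  -- rule (1b): `[CY] = [DS] + [E]`
  have h1b : KZ.of CY - KZ.of DS - KZ.of E ∈ KZ.relations := by
    refine KZ.integrandAddRel_subset_relations ⟨2, CY, DS, E, hDSd.trans hCYd.symm, hEd.trans hCYd.symm,
      fun z hz => ?_, rfl⟩
    rw [hCYd] at hz
    obtain ⟨⟨hz0, hzy⟩, hz1, -⟩ := hz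
    rw [hCYi, hDSi, hEi]
    simp only [Pi.add_apply]
    have h1 : 1 - x * z 0 ≠ 0 := by nlinarith
    have h2 : z 0 ≠ 0 := hz0.ne'
    have key : x / (1 - x * z 0) + 1 / z 0 = 1 / (z 0 * (1 - x * z 0)) := by
      rw [div_add_div _ _ h1 h2, div_eq_div_iff (mul_ne_zero h1 h2) (mul_ne_zero h2 h1)]
      ring
    rw [← key, add_div]
  -- the fibred product rule `1/(1−t) = (1/(1−xt)) · ((1−xt)/(1−t))`
  have hσ : IsSemialgebraic ℚ {p : Fin 1 → ℝ | 0 < p 0 ∧ p 0 < y} := isSemialgebraic_logIvl isAlgebraic_zero hy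
  have hu : IsSemialgebraicFunOn ℚ {p : Fin 1 → ℝ | 0 < p 0 ∧ p 0 < y} (fun p => 1 / (1 - x * p 0)) :=
    (abel_isSemialgebraicFunOn_moebius hσ 0 isAlgebraic_zero isAlgebraic_one hx.neg isAlgebraic_one
      (fun p hp => by have := hp.1; have := hp.2; nlinarith)).congr fun p _ => by simp; ring
  have hw : IsSemialgebraicFunOn ℚ {p : Fin 1 → ℝ | 0 < p 0 ∧ p 0 < y} (fun p => (1 - x * p 0) / (1 - p 0)) :=
    (abel_isSemialgebraicFunOn_moebius hσ 0 hx.neg isAlgebraic_one isAlgebraic_one.neg isAlgebraic_one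
      (fun p hp => by have := hp.2; nlinarith)).congr fun p _ => by simp; ring
  have hmul : KZ.of By - KZ.of Cxy - KZ.of E ∈ KZ.relations := by
    refine KZ.of_sub_of_sub_mem_relations_mul (g := fun p : Fin 1 → ℝ => 1 / p 0) hσ hu hw
      (fun p hp => by rw [le_div_iff₀ (by nlinarith [hp.1, hp.2])]; nlinarith [hp.1, hp.2])
      (fun p hp => by rw [le_div_iff₀ (by linarith [hp.2])]; nlinarith [hp.1, hp.2])
      By Cxy E ?_ (fun z _ => by rw [hByi]; rfl) ?_ (fun z _ => by rw [hCxyi]; rfl) ?_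
      (fun z _ => by rw [hEi]; rfl)
    · rw [hByd]
      ext z
      simp only [mem_setOf_eq, KZlog.band, Fin.init, Fin.castSucc_zero, Fin.last]
      change (0 < z 0 ∧ z 0 < y ∧ 1 ≤ z 1 ∧ z 1 ≤ 1 / (1 - z 0)) ↔
        ((0 < z 0 ∧ z 0 < y) ∧ 1 ≤ z 1 ∧ z 1 ≤ 1 / (1 - x * z 0) * ((1 - x * z 0) / (1 - z 0)))
      have key : ∀ t : ℝ, t < y → 1 / (1 - x * t) * ((1 - x * t) / (1 - t)) = 1 / (1 - t) := fun t ht => by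
        have h1 : 1 - x * t ≠ 0 := by nlinarith
        have h2 : 1 - t ≠ 0 := by linarith
        rw [div_mul_div_comm, one_mul, div_eq_div_iff (mul_ne_zero h1 h2) h2]
        ring
      constructor
      · rintro ⟨h0, h1, h2, h3⟩; exact ⟨⟨h0, h1⟩, h2, by rwa [key _ h1]⟩
      · rintro ⟨⟨h0, h1⟩, h2, h3⟩; exact ⟨h0, h1, h2, by rwa [key _ h1] at h3⟩
    · rw [hCxyd]
      ext z
      simp only [mem_setOf_eq, KZlog.band, Fin.init, Fin.castSucc_zero, Fin.last]
      rfl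
    · rw [hEd]
      ext z
      simp only [mem_setOf_eq, KZlog.band, Fin.init, Fin.castSucc_zero, Fin.last]
      rfl
  -- bookkeeping
  have : KZ.of Lx + KZ.of Ly - KZ.of Lxy - KZ.of LX - KZ.of LY - KZ.of M =
      (KZ.of Lx - KZ.of LX - KZ.of CX) + (KZ.of Ly - KZ.of By) - (KZ.of Lxy - KZ.of Cxy) -
      (KZ.of LY - KZ.of CY) - (KZ.of M - KZ.of CX + KZ.of DS) + (KZ.of By - KZ.of Cxy - KZ.of E) -
      (KZ.of CY - KZ.of DS - KZ.of E) := by abel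
  rw [this]
  exact KZ.relations.sub_mem (KZ.relations.add_mem (KZ.relations.sub_mem (KZ.relations.sub_mem
    (KZ.relations.sub_mem (KZ.relations.add_mem hX hLy') hxy) hY) hlog) hmul) h1b

end Summit.KontsevichZagierPeriods.HyperbolicBloch.OffTetraSectorKernel

end
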